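import Mathlib.RingTheory.ZariskisMainTheorem
import Mathlib.RingTheory.IntegralClosure.IntegrallyClosed
import Mathlib.RingTheory.LocalRing.MaximalIdeal.Basic
import HarnessLib

/-!
# Zariski's Main Theorem for a normal local domain: no proper birational quasi-finite extension ([CoP1] Prop. 9.3: "By (52) and Zariski's Main Theorem, `R` lies below `S′`")

Topic: `Literature/AlgebraicGeometry/Resolution`. PROOF side of `CossartPiltant2019ReductionP`
(`ArithmeticalThreefoldsLocal.lean`), input (C4), decomposition layer of [CoP1] Prop. 9.3
(hypothesis `hDec` of `cossartPiltant2019ReductionP_of_cjs_of_stableInertiaHensel`). The end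
of the printed proof (HAL p. 28):

> By (46), (47) and (51), we have `√(({Fᵢ}, {Hⱼ}) S′) = m_{S′}` (52). Let `R̄` be the integral
> closure of `R₁[{Fᵢ}, {Hⱼ}] ⊂ S′ ∩ K`. We have `R := R̄_{m_{S′} ∩ R̄} < S′` and `QF(R) = K`.
> By (52) and Zariski's Main Theorem ([40], theorem 1 on p.41), `R` lies below `S′`.

"`R` lies below `S′`" means that `S′` IS the normal local model `R′` of `K′` lying above `R`
(the local ring of the integral closure of `R` in `K′` at the centre of the valuation); since
`R′ ≤ S′` automatically, the content is `S′ ≤ R′`, i.e. Zariski's Main Theorem in Nagata's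
form: a normal local domain has no proper finite-type extension inside its fraction field that
is quasi-finite (unramified in Nagata's sense) at a prime above the maximal ideal. The same
step closes Cossart–Piltant 2019, Prop. 4.6 (arXiv v1 p. 53: "`√(P′𝒪_{Ŷ,ŷ}) = m_ŷ`, so
`𝒪_{Ŷ,ŷ} = T′_{P′}`"). We derive it from Mathlib's algebraic Zariski's Main Theorem
(`Algebra.ZariskisMainProperty.of_finiteType`, Stacks 00Q9):

* `eq_of_liesOver_of_forall_pow_mem` — PROVED: (52)-type input: if `𝔫` is maximal and every
  element of `𝔫` has a power in `𝔪_A T`, then `𝔫` is the only prime of `T` above `𝔪_A`;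
* `quasiFiniteAt_of_forall_eq` — PROVED: a prime that is alone in its fibre is quasi-finite
  (`Algebra.QuasiFiniteAt.of_isOpen_singleton_fiber`);
* `mem_range_of_quasiFiniteAt`, `eq_bot_of_quasiFiniteAt` — PROVED, **ZMT for a normal local
  domain**: `A` an integrally closed local domain with fraction field `F`, `T ⊆ F` an
  `A`-subalgebra of finite type, `𝔫` a prime of `T` above `𝔪_A` at which `T` is quasi-finite
  ⟹ `T = A`;
* `eq_bot_of_forall_pow_mem` — PROVED, the form used in [CoP1]: `𝔫` maximal above `𝔪_A` with
  `√(𝔪_A T) ⊇ 𝔫` ⟹ `T = A` (hence `T_𝔫 = A`: "`R` lies below `S′`").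

Everything is PROVED; no named facts, definitions, instances or notation are introduced.

## Sources

* V. Cossart, O. Piltant, J. Algebra 320 (2008) 1051–1082: proof of Prop. 9.3, (52) and the
  last paragraph (HAL hal-00139124, p. 28). [CossartPiltant2008]
* V. Cossart, O. Piltant, J. Algebra 529 (2019) = arXiv:1412.0868: end of the proof of
  Prop. 4.6 (arXiv v1 p. 53). [CossartPiltant2019]
* M. Nagata, *Local Rings* (1962), (37.4) (Zariski's Main Theorem); The Stacks Project,
  Tag 00Q9. [folklore]
-/

namespace Literature.AlgebraicGeometry.Resolution

section Fibre

variable {R S : Type*} [CommRing R] [CommRing S] [Algebra R S]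

/-- **(52)-type input.** If `𝔫` is a maximal ideal of `S` and every element of `𝔫` has a
power in `P S` (`√(P S) ⊇ 𝔫`), then `𝔫` is the only prime of `S` lying over `P`.
[cite: CossartPiltant2008, proof of Prop. 9.3, (52) (HAL p. 28)] -/
theorem eq_of_liesOver_of_forall_pow_mem (P : Ideal R) (𝔫 : Ideal S) [𝔫.IsMaximal]
    (hrad : ∀ y ∈ 𝔫, ∃ n : ℕ, y ^ n ∈ P.map (algebraMap R S))
    (Q : Ideal S) [Q.IsPrime] (hQ : P ≤ Q.under R) : Q = 𝔫 := by
  have hle : 𝔫 ≤ Q := by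
    intro y hy
    obtain ⟨n, hn⟩ := hrad y hy
    have hPQ : P.map (algebraMap R S) ≤ Q := Ideal.map_le_iff_le_comap.mpr hQ
    exact Ideal.IsPrime.mem_of_pow_mem ‹_› n (hPQ hn)
  exact (Ideal.IsMaximal.eq_of_le ‹_› Ideal.IsPrime.ne_top' hle).symm

/-- **A prime alone in its fibre is quasi-finite** (for a finite-type algebra): if every prime
`Q` of `S` with `Q ∩ R = 𝔫 ∩ R` equals `𝔫`, then `S` is quasi-finite at `𝔫`
(`{𝔫}` is all of, hence open in, its fibre; Mathlib's
`Algebra.QuasiFiniteAt.of_isOpen_singleton_fiber`). [cite: CossartPiltant2008, proof of Prop. 9.3 (HAL p. 28), "Zariski's Main Theorem"] -/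
theorem quasiFiniteAt_of_forall_eq [Algebra.FiniteType R S] (𝔫 : Ideal S) [h𝔫 : 𝔫.IsPrime]
    (h : ∀ Q : Ideal S, Q.IsPrime → Q.under R = 𝔫.under R → Q = 𝔫) :
    Algebra.QuasiFiniteAt R 𝔫 := by
  have := Algebra.QuasiFiniteAt.of_isOpen_singleton_fiber (R := R) ⟨𝔫, h𝔫⟩ (by
    convert isOpen_univ
    ext ⟨Q, hQ⟩
    simp only [Set.mem_singleton_iff, Set.mem_univ, iff_true]
    apply Subtype.ext
    apply PrimeSpectrum.ext
    have hQ' : (PrimeSpectrum.comap (algebraMap R S) Q) =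
        PrimeSpectrum.comap (algebraMap R S) ⟨𝔫, h𝔫⟩ := hQ
    exact h Q.asIdeal Q.isPrime (congrArg PrimeSpectrum.asIdeal hQ'))
  exact this

end Fibre

section NormalLocal

variable {A F : Type*} [CommRing A] [IsDomain A] [IsLocalRing A] [Field F] [Algebra A F]
  [IsFractionRing A F] [IsIntegrallyClosed A] (T : Subalgebra A F) [Algebra.FiniteType A T]
  (𝔫 : Ideal T) [𝔫.IsPrime]

/-- **Zariski's Main Theorem for a normal local domain.** Let `A` be an integrally closed local
domain with fraction field `F`, `T ⊆ F` an `A`-subalgebra of finite type and `𝔫` a prime of `T`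
lying over `𝔪_A` at which `T` is quasi-finite. Then every element of `T` lies in `A`: by the
algebraic Main Theorem there is `r ∈ T ∖ 𝔫`, integral over `A` — so `r ∈ A ∖ 𝔪_A` is a unit of
`A` — with `rᵐ x` integral over `A`, i.e. in `A`, for every `x ∈ T`.
[cite: CossartPiltant2008, proof of Prop. 9.3 (HAL p. 28), "By (52) and Zariski's Main Theorem ([40], theorem 1 on p.41), `R` lies below `S′`"]
[cite: CossartPiltant2019, proof of Prop. 4.6 (arXiv v1 p. 53), "so `𝒪_{Ŷ,ŷ} = T′_{P′}`"] -/
theorem mem_range_of_quasiFiniteAt (h𝔫 : 𝔫.under A = IsLocalRing.maximalIdeal A)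
    [Algebra.QuasiFiniteAt A 𝔫] (x : F) (hx : x ∈ T) : x ∈ (algebraMap A F).range := by
  obtain ⟨r, hr𝔫, hrint, hall⟩ :=
    Algebra.zariskisMainProperty_iff.mp (Algebra.ZariskisMainProperty.of_finiteType (R := A) 𝔫)
  -- `r ∈ A`, a unit
  obtain ⟨a₀, ha₀⟩ := IsIntegrallyClosed.isIntegral_iff.mp (hrint.map T.val)
  have ha₀T : algebraMap A T a₀ = r := Subtype.ext (by
    rw [Subalgebra.coe_algebraMap]; exact ha₀)
  have ha₀u : IsUnit a₀ := by
    by_contra hu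
    have hmem : a₀ ∈ IsLocalRing.maximalIdeal A := (IsLocalRing.mem_maximalIdeal a₀).mpr hu
    rw [← h𝔫, Ideal.under_def, Ideal.mem_comap, ha₀T] at hmem
    exact hr𝔫 hmem
  obtain ⟨u, hu⟩ := ha₀u
  have hr0 : (r : F) ≠ 0 := by
    change T.val r ≠ 0
    rw [← ha₀, ← hu]
    exact IsFractionRing.to_map_ne_zero_of_mem_nonZeroDivisors
      (mem_nonZeroDivisors_of_ne_zero (Units.ne_zero u))
  -- `rᵐ x ∈ A`
  obtain ⟨m, hm⟩ := hall ⟨x, hx⟩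
  obtain ⟨a₁, ha₁⟩ := IsIntegrallyClosed.isIntegral_iff.mp (hm.map T.val)
  have ha₁' : algebraMap A F a₁ = (r : F) ^ m * x := by
    rw [ha₁]; rfl
  refine ⟨a₁ * ((↑u⁻¹ : A)) ^ m, ?_⟩
  have hinv : algebraMap A F (↑u⁻¹ : A) = (r : F)⁻¹ := by
    apply eq_inv_of_mul_eq_one_left
    change algebraMap A F (↑u⁻¹ : A) * T.val r = 1
    rw [← ha₀, ← hu, ← map_mul, Units.inv_mul, map_one]
  rw [map_mul, map_pow, hinv, ha₁', inv_pow, mul_comm, ← mul_assoc, inv_mul_cancel₀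
    (pow_ne_zero _ hr0), one_mul]

/-- `T = A` under the hypotheses of `mem_range_of_quasiFiniteAt`.
[cite: CossartPiltant2008, proof of Prop. 9.3 (HAL p. 28)] -/
theorem eq_bot_of_quasiFiniteAt (h𝔫 : 𝔫.under A = IsLocalRing.maximalIdeal A)
    [Algebra.QuasiFiniteAt A 𝔫] : T = ⊥ :=
  eq_bot_iff.mpr (fun x hx => Algebra.mem_bot.mpr (mem_range_of_quasiFiniteAt T 𝔫 h𝔫 x hx))

/-- **"By (52) and Zariski's Main Theorem, `R` lies below `S′`"**: `A` an integrally closed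
local domain with fraction field `F`, `T ⊆ F` an `A`-subalgebra of finite type, `𝔫` a MAXIMAL
ideal of `T` above `𝔪_A` such that every element of `𝔫` has a power in `𝔪_A T` (i.e.
`√(𝔪_A T) = 𝔫`, (52)). Then `T = A` (so the local ring `T_𝔫` is `A` itself).
[cite: CossartPiltant2008, proof of Prop. 9.3, (52) and last paragraph (HAL p. 28)]
[cite: CossartPiltant2019, proof of Prop. 4.6 (arXiv v1 p. 53)] -/
theorem eq_bot_of_forall_pow_mem (𝔫 : Ideal T) [𝔫.IsMaximal]
    (h𝔫 : 𝔫.under A = IsLocalRing.maximalIdeal A)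
    (hrad : ∀ y ∈ 𝔫, ∃ n : ℕ, y ^ n ∈ (IsLocalRing.maximalIdeal A).map (algebraMap A T)) :
    T = ⊥ := by
  haveI : Algebra.QuasiFiniteAt A 𝔫 :=
    quasiFiniteAt_of_forall_eq 𝔫 (fun Q hQ hQu =>
      eq_of_liesOver_of_forall_pow_mem (IsLocalRing.maximalIdeal A) 𝔫 hrad Q
        (by rw [hQu, h𝔫]))
  exact eq_bot_of_quasiFiniteAt T 𝔫 h𝔫

end NormalLocal

end Literature.AlgebraicGeometry.Resolution
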